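import Literature.NumberTheory.Sieve.LargestPrimeFactorCubicS1Family
import Literature.NumberTheory.Sieve.LargestPrimeFactorCubicRegionBridge
import HarnessLib

/-!
# Heath-Brown 2001 (PLMS), Lemma 4 for the generators of `regionGens`: `ρ((α)) = 1`, the root
# `k = −uB`, `#𝒜_(α) = #{X < n ≤ 2X : N(α) ∣ n − k}`, and (3.5)

Topic `Literature/NumberTheory/Sieve`; a PROVED layer (no definitions, no named facts) under the named fact
`Irving2015_largestPrimeFactor_cubic` (`LargestPrimeFactorCubic.lean`): the analogues, for the cube
family `regionGens X m` of `…Region`, of the parallel seat's `…S1Family` facts for its thin family `gens`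
(the proofs are the same, resting on the generic `…Generators` lemmas).  Source: D. R. Heath-Brown, *The
largest prime factor of `X³ + 2`*, Proc. London Math. Soc. (3) 82 (2001) 554–596, Lemma 4 p. 9 and §3
pp. 565–568 ((3.5)).  This is the first input of the remainder estimate `S₁ = o(X)` (Lemma 5) for
`regionGens`.

* `isCoprime_of_mem_regionGens`, `normf_pos_of_mem_regionGens`, `normNat_cast_of_mem_regionGens`;
* `uRoot_spec_R`, `wRoot_spec_R`, `natCast_add_θint_mem_genIdeal_iff_R`, **`Acount_eq_card_filter_R`**;
* **`exists_int_phase_R`** ((3.5) in real form) and `abs_E_div_le_R` (`|E/(qN(α))| ≤ 1250 X^{1+2δ}/(X^{1+δ}X^{1+3δ/2})`).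

## References

* D. R. Heath-Brown, *The largest prime factor of `X³ + 2`*, Proc. London Math. Soc. (3) 82 (2001)
  554–596, Lemma 4 p. 9, §3 pp. 565–568. [`HeathBrown2001LargestPrimeFactorCubic`]

## Mathlib / tree search

Tree: `Cf`, `Bf`, `Ef`, `uRoot`, `wRoot`, `kRoot` (`…S1Family`), `exists_inverse_C`, `exists_inverse_C_mod_q`,
`θint_sub_mem_span`, `natCast_add_θint_mem_span_iff`, `isCoprime_norm_q`, `qN_dvd` (`…Generators`),
`regionGens`, `mem_regionGens`, `inRegion_of_mem_regionGens`, `normNat_real_of_mem_regionGens`, `normf_eq_normForm`,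
`rvec` (`…Region`), `goodCorners_eq_image`, `isGoodCube_iff_goodIdx`, `hbPair_of_good` (`…RegionBridge`),
`HBPair.odd_a` (`…ABCount`), `window_bounds` (`…GoodCubes`), `Acount`, `genIdeal`, `normNat`, `normf`, `qf`.
-/

noncomputable section

open NumberField Finset Real

namespace Literature.NumberTheory.Sieve.HeathBrown2001

open LargestPrimeFactorCubic LFunctions.CubeRootTwoField CubicSieve
open scoped Classical

/-! ### Coprimality and positivity for `v ∈ regionGens` -/

/-- For `v = (a,b,c) ∈ regionGens X m`: `q = a³ − 2b³ > 0`, `HBPair a b |q|`, and `(2, q) = (C, q) = (D, q) = 1`.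
[cite: HeathBrown2001LargestPrimeFactorCubic, (2.10)–(2.11), (2.14)–(2.16)] -/
theorem isCoprime_of_mem_regionGens {X m : ℕ} {v : ℕ × ℕ × ℕ} (hv : v ∈ regionGens X m) :
    0 < qf v.1 v.2.1 ∧ HBPair v.1 v.2.1 (qf v.1 v.2.1).natAbs ∧
    IsCoprime (2 : ℤ) ((v.1 : ℤ) ^ 3 - 2 * (v.2.1 : ℤ) ^ 3) ∧
    IsCoprime ((v.2.1 : ℤ) ^ 2 - v.1 * v.2.2) ((v.1 : ℤ) ^ 3 - 2 * (v.2.1 : ℤ) ^ 3) ∧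
    IsCoprime ((v.1 : ℤ) ^ 2 + v.2.1 * v.2.2) ((v.1 : ℤ) ^ 3 - 2 * (v.2.1 : ℤ) ^ 3) := by
  rw [mem_regionGens] at hv
  obtain ⟨ABC, hABC, hcube, hbase, hcc⟩ := hv
  rw [goodCorners, mem_filter] at hABC
  have hq : 0 < qf v.1 v.2.1 := qf_pos_of_good hABC.2 hcube
  have hpair : HBPair v.1 v.2.1 (qf v.1 v.2.1).natAbs := hbPair_of_good hABC.2 hcube hbase
  have h6 : Nat.Coprime (qf v.1 v.2.1).natAbs 6 := hbase.2.1
  have h2 : IsCoprime (2 : ℤ) ((v.1 : ℤ) ^ 3 - 2 * (v.2.1 : ℤ) ^ 3) := by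
    have h2' : Nat.Coprime (qf v.1 v.2.1).natAbs 2 := Nat.Coprime.coprime_dvd_right (by norm_num) h6
    rw [Int.isCoprime_iff_gcd_eq_one, Int.gcd_comm]
    rw [Int.gcd, show (2 : ℤ).natAbs = 2 from rfl]
    exact h2'
  obtain ⟨hC, hD⟩ := hcc
  exact ⟨hq, hpair, h2, Int.isCoprime_iff_gcd_eq_one.2 hC, Int.isCoprime_iff_gcd_eq_one.2 hD⟩

/-- `N(α) > 0` and `(normNat v : ℤ) = normf v` for `v ∈ regionGens`. [folklore] -/
theorem normf_pos_of_mem_regionGens {X m : ℕ} {v : ℕ × ℕ × ℕ} (hv : v ∈ regionGens X m) :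
    0 < normf v ∧ (normNat v : ℤ) = normf v := by
  obtain ⟨-, hpos⟩ := normNat_real_of_mem_regionGens hv
  have hposZ : 0 < normf v := by
    have : (0 : ℝ) < normf v := by rw [normf_eq_normForm]; exact hpos
    exact_mod_cast this
  exact ⟨hposZ, by rw [normNat, Int.natAbs_of_nonneg hposZ.le]⟩

/-! ### The roots -/

/-- `uC ≡ 1 (mod N(α))`. [cite: HeathBrown2001LargestPrimeFactorCubic, Lemma 4] -/
theorem uRoot_spec_R {X m : ℕ} {v : ℕ × ℕ × ℕ} (hv : v ∈ regionGens X m) : uRoot v * Cf v ≡ 1 [ZMOD normf v] := by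
  obtain ⟨-, -, -, hC, -⟩ := isCoprime_of_mem_regionGens hv
  rw [uRoot, dif_pos hC]
  have h := Classical.choose_spec (exists_inverse_C hC)
  simpa [Cf, normf] using h

/-- `wC ≡ 1 (mod q)`. [cite: HeathBrown2001LargestPrimeFactorCubic, (3.5)] -/
theorem wRoot_spec_R {X m : ℕ} {v : ℕ × ℕ × ℕ} (hv : v ∈ regionGens X m) : wRoot v * Cf v ≡ 1 [ZMOD qf v.1 v.2.1] := by
  obtain ⟨-, -, -, hC, -⟩ := isCoprime_of_mem_regionGens hv
  rw [wRoot, dif_pos hC]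
  have h := Classical.choose_spec (exists_inverse_C_mod_q hC)
  simpa [Cf, qf] using h

/-- **`n + ∛2 ∈ (α) ↔ N(α) ∣ n − k`**, `k = kRoot α`, for `α ∈ regionGens`. [cite: HeathBrown2001LargestPrimeFactorCubic, Lemma 4] -/
theorem natCast_add_θint_mem_genIdeal_iff_R {X m : ℕ} {v : ℕ × ℕ × ℕ} (hv : v ∈ regionGens X m) (n : ℕ) :
    (n : 𝓞 K) + θint ∈ genIdeal v ↔ (normNat v : ℤ) ∣ (n : ℤ) - kRoot v := by
  obtain ⟨hpos, hcast⟩ := normf_pos_of_mem_regionGens hv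
  have hu := uRoot_spec_R hv
  obtain ⟨a, b, c⟩ := v
  simp only [Cf, normf] at hu
  have hpos' : 0 < (a : ℤ) ^ 3 + 2 * (b : ℤ) ^ 3 + 4 * (c : ℤ) ^ 3 - 6 * a * b * c := by simpa [normf] using hpos
  have h := natCast_add_θint_mem_span_iff hpos' hu n
  rw [genIdeal, gen]
  rw [h, hcast, kRoot, Bf, normf]
  simp only [sub_neg_eq_add]

/-- **`#𝒜_{(α)} = #{X < n ≤ 2X : N(α) ∣ n − k}`** for `α ∈ regionGens`. [cite: HeathBrown2001LargestPrimeFactorCubic, §3 p. 566] -/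
theorem Acount_eq_card_filter_R {X m : ℕ} {v : ℕ × ℕ × ℕ} (hv : v ∈ regionGens X m) (Y : ℕ) :
    Acount Y v = #((Ioc Y (2 * Y)).filter fun n : ℕ => (normNat v : ℤ) ∣ (n : ℤ) - kRoot v) := by
  unfold Acount
  congr 1
  exact filter_congr (fun n _ => natCast_add_θint_mem_genIdeal_iff_R hv n)

/-- **(3.5) in real form** for `α ∈ regionGens` and any real `Y`:
`(Y − k)/N(α) − (Y/N(α) − ab·w/q) − (−E/(qN(α))) ∈ ℤ`. [cite: HeathBrown2001LargestPrimeFactorCubic, (3.5)] -/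
theorem exists_int_phase_R {X m : ℕ} {v : ℕ × ℕ × ℕ} (hv : v ∈ regionGens X m) (Y : ℝ) :
    ∃ m' : ℤ, (Y - kRoot v) / normNat v - (Y / normNat v - (v.1 : ℝ) * v.2.1 * wRoot v / qf v.1 v.2.1)
      - (-(Ef v : ℝ) / (qf v.1 v.2.1 * normNat v)) = m' := by
  obtain ⟨hq, -, h2, hC, hD⟩ := isCoprime_of_mem_regionGens hv
  obtain ⟨hNpos, hNcastZ⟩ := normf_pos_of_mem_regionGens hv
  have hu := uRoot_spec_R hv
  have hw := wRoot_spec_R hv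
  have hNq := isCoprime_norm_q h2 hC hD
  obtain ⟨a, b, c⟩ := v
  simp only [Cf, normf, qf] at hu hw
  obtain ⟨m, hm⟩ := qN_dvd hNq hu hw
  refine ⟨-m, ?_⟩
  have hN0 : (0 : ℝ) < normNat (a, b, c) := by
    have : (0 : ℤ) < normNat (a, b, c) := by rw [hNcastZ]; exact hNpos
    exact_mod_cast this
  have hNcast : ((normNat (a, b, c) : ℕ) : ℝ) = ((a : ℝ) ^ 3 + 2 * (b : ℝ) ^ 3 + 4 * (c : ℝ) ^ 3 - 6 * a * b * c) := by
    have h' : ((normNat (a, b, c) : ℤ) : ℝ) = ((normf (a, b, c) : ℤ) : ℝ) := by rw [hNcastZ]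
    simpa [normf] using h'
  have hq0 : (0 : ℝ) < qf a b := by exact_mod_cast hq
  have hqcast : ((qf a b : ℤ) : ℝ) = (a : ℝ) ^ 3 - 2 * (b : ℝ) ^ 3 := by simp [qf]
  have hNr0 : ((normNat (a, b, c) : ℕ) : ℝ) ≠ 0 := hN0.ne'
  have hqr0 : ((qf a b : ℤ) : ℝ) ≠ 0 := hq0.ne'
  have hmR : (kRoot (a, b, c) : ℝ) * ((qf a b : ℤ) : ℝ) -
      (a : ℝ) * b * wRoot (a, b, c) * ((normNat (a, b, c) : ℕ) : ℝ) - (Ef (a, b, c) : ℝ) =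
      ((qf a b : ℤ) : ℝ) * ((normNat (a, b, c) : ℕ) : ℝ) * m := by
    have h' := congrArg (Int.cast : ℤ → ℝ) hm
    push_cast at h'
    rw [hNcast, hqcast, kRoot, Bf, Ef]
    push_cast
    linear_combination h'
  have e1 : (Y - kRoot (a, b, c)) / ((normNat (a, b, c) : ℕ) : ℝ) -
      (Y / ((normNat (a, b, c) : ℕ) : ℝ) - (a : ℝ) * b * wRoot (a, b, c) / ((qf a b : ℤ) : ℝ))
      - (-(Ef (a, b, c) : ℝ) / (((qf a b : ℤ) : ℝ) * ((normNat (a, b, c) : ℕ) : ℝ))) =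
      -((kRoot (a, b, c) : ℝ) * ((qf a b : ℤ) : ℝ) -
        (a : ℝ) * b * wRoot (a, b, c) * ((normNat (a, b, c) : ℕ) : ℝ) - (Ef (a, b, c) : ℝ)) /
        (((qf a b : ℤ) : ℝ) * ((normNat (a, b, c) : ℕ) : ℝ)) := by
    field_simp
    ring
  simp only
  rw [e1, hmR]
  field_simp
  push_cast
  ring

/-- **`|E/(qN(α))| ≤ 1250·X^{1+2δ}/(X^{1+δ}·X^{1+3δ/2})`** for `α ∈ regionGens X m` (all coordinates are
`≤ 5N₂^{1/3}`, `q > X^{1+δ}`, `N(α) > X^{1+3δ/2}`; Heath-Brown's `O(N³M⁻⁶)`). [cite: HeathBrown2001LargestPrimeFactorCubic, §3 p. 568] -/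
theorem abs_E_div_le_R {X m : ℕ} (hX : 1 ≤ X) {v : ℕ × ℕ × ℕ} (hv : v ∈ regionGens X m) :
    |(-(Ef v : ℝ) / (qf v.1 v.2.1 * normNat v))| ≤
      1250 * (X : ℝ) ^ (1 + 2 * hbδ) / ((X : ℝ) ^ (1 + hbδ) * (X : ℝ) ^ (1 + 3 * hbδ / 2)) := by
  have hR := inRegion_of_mem_regionGens hv
  obtain ⟨hcast, hpos⟩ := normNat_real_of_mem_regionGens hv
  obtain ⟨hN1, hN2, hw1, hw2, hq⟩ := hR
  have hX0 : (0 : ℝ) < X := by exact_mod_cast hX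
  obtain ⟨⟨h1, h2, h3⟩, -⟩ := window_bounds hpos hw1 hw2
  set cN := (normForm (rvec v)) ^ ((1 : ℝ) / 3) with hcN
  have hcN0 : 0 ≤ cN := by rw [hcN]; positivity
  have hcN3 : cN ^ 3 = normForm (rvec v) := rpow_third_pow_three hpos.le
  have hc2 : cN ^ 3 < (X : ℝ) ^ (1 + 2 * hbδ) := by rw [hcN3]; exact hN2
  simp only [rvec] at h1 h2 h3 hq
  have ha : (v.1 : ℝ) ≤ 5 * cN := by linarith [le_abs_self (v.1 : ℝ)]
  have hb : (v.2.1 : ℝ) ≤ 5 * cN := by linarith [le_abs_self (v.2.1 : ℝ)]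
  have hc : (v.2.2 : ℝ) ≤ 5 * cN := by linarith [le_abs_self (v.2.2 : ℝ)]
  have ha0 : (0 : ℝ) ≤ v.1 := Nat.cast_nonneg _
  have hb0 : (0 : ℝ) ≤ v.2.1 := Nat.cast_nonneg _
  have hc0 : (0 : ℝ) ≤ v.2.2 := Nat.cast_nonneg _
  -- `|E| ≤ 2a²c + 4bc² + 4ab² ≤ 10 (5cN)³ = 1250 cN³ ≤ 1250 X^{1+2δ}`
  have hE : |(Ef v : ℝ)| ≤ 1250 * (X : ℝ) ^ (1 + 2 * hbδ) := by
    have e : (Ef v : ℝ) = 2 * (v.1 : ℝ) ^ 2 * v.2.2 + 4 * v.2.1 * (v.2.2 : ℝ) ^ 2 - 4 * v.1 * (v.2.1 : ℝ) ^ 2 := by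
      simp [Ef]
    rw [e, abs_le]
    have t1 : (v.1 : ℝ) ^ 2 * v.2.2 ≤ (5 * cN) ^ 2 * (5 * cN) :=
      mul_le_mul (pow_le_pow_left₀ ha0 ha 2) hc hc0 (by positivity)
    have t2 : (v.2.1 : ℝ) * (v.2.2 : ℝ) ^ 2 ≤ (5 * cN) * (5 * cN) ^ 2 :=
      mul_le_mul hb (pow_le_pow_left₀ hc0 hc 2) (by positivity) (by positivity)
    have t3 : (v.1 : ℝ) * (v.2.1 : ℝ) ^ 2 ≤ (5 * cN) * (5 * cN) ^ 2 :=
      mul_le_mul ha (pow_le_pow_left₀ hb0 hb 2) (by positivity) (by positivity)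
    constructor <;> nlinarith [mul_nonneg (mul_nonneg ha0 ha0) hc0, mul_nonneg hb0 (mul_nonneg hc0 hc0),
      mul_nonneg ha0 (mul_nonneg hb0 hb0), pow_nonneg hcN0 3]
  -- denominators
  have hqR : (X : ℝ) ^ (1 + hbδ) < ((qf v.1 v.2.1 : ℤ) : ℝ) := by
    have : ((qf v.1 v.2.1 : ℤ) : ℝ) = (v.1 : ℝ) ^ 3 - 2 * (v.2.1 : ℝ) ^ 3 := by simp [qf]
    rw [this]; exact hq
  have hNR : (X : ℝ) ^ (1 + 3 * hbδ / 2) < (normNat v : ℝ) := by rw [hcast]; exact hN1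
  have hq0 : 0 < ((qf v.1 v.2.1 : ℤ) : ℝ) := lt_trans (by positivity) hqR
  have hN0 : 0 < (normNat v : ℝ) := lt_trans (by positivity) hNR
  rw [abs_div, abs_neg, abs_mul, abs_of_pos hq0, abs_of_pos hN0]
  rw [div_le_div_iff₀ (mul_pos hq0 hN0) (by positivity)]
  have hXa : 0 < (X : ℝ) ^ (1 + hbδ) := by positivity
  have hXb : 0 < (X : ℝ) ^ (1 + 3 * hbδ / 2) := by positivity
  calc |(Ef v : ℝ)| * ((X : ℝ) ^ (1 + hbδ) * (X : ℝ) ^ (1 + 3 * hbδ / 2))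
      ≤ (1250 * (X : ℝ) ^ (1 + 2 * hbδ)) * ((X : ℝ) ^ (1 + hbδ) * (X : ℝ) ^ (1 + 3 * hbδ / 2)) :=
        mul_le_mul_of_nonneg_right hE (by positivity)
    _ ≤ (1250 * (X : ℝ) ^ (1 + 2 * hbδ)) * (((qf v.1 v.2.1 : ℤ) : ℝ) * (normNat v : ℝ)) := by
        refine mul_le_mul_of_nonneg_left ?_ (by positivity)
        exact mul_le_mul hqR.le hNR.le hXb.le hq0.le

end Literature.NumberTheory.Sieve.HeathBrown2001
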